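import Summits.NavierStokesRegularity.NavierStokesRegularity.Theorems.AdaptedFrequencyFrequencyRigidityClassicalSuitableSlab
import Literature.Analysis.FluidPDE.CKNEpsilonRegularityHolds
import Literature.Analysis.FluidPDE.NecasRuzickaSverakEpsilon
import HarnessLib

/-!
# Crux `FiniteDissipationLiouville` (stmt-NavierStokesRegularity-22144): ε-regularity at the TOP
# points of a classical solution on `(−∞, 0) × ℝ³` (file 1/3 of the finite-singular-set leaf)

Theorems file of route `LerayQuarterDissipation` (lead prover g4; `--supports` the crux, both
registered stubs). Navier–Stokes regularity is NOT proved by anything here; no summit is.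

**Main results.** Let `(u, p)` be a classical solution of Navier–Stokes (`ν = 1`, `f = 0`) on the
time set `(−∞, 0)` (`IsClassicalNSSolutionOn (Iio 0) 1 0 u p`; nothing is assumed at `t = 0`).

* `exists_epsilon_apex` — **one-scale ε-regularity at the final time.** There are absolute
  `ε₀, C₀ > 0` (the constants of the tree's PROVED Caffarelli–Kohn–Nirenberg criterion in
  Lemarié-Rieusset's one-scale form, Thm. 14.4, `lemarieRieusset_epsilon_regularity_holds`) such
  that for every `x₀` and `r > 0`:
  `∫_{−2r²}^{0} ∫_{B(x₀,r)} (|u|³ + |p|^{3/2}) ≤ ε₀³ r²` implies `|u| ≤ C₀ ε₀ / r` on the backward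
  cylinder `Q_{r/2}(0, x₀) = (−r²/4, 0) × B(x₀, r/2)` reaching the final time. (Every cylinder
  `Q_r(t₀, x₀)` with `−r²/8 < t₀ < 0` lies in `(−2r², 0) × B(x₀, r)` and its closure lies in the
  open slab, where `(u, p)` is suitable (`stub_classicalSuitableSlab`); the a.e. bounds on the
  `Q_{r/2}(t₀, x₀)` are pointwise by continuity and exhaust `Q_{r/2}(0, x₀)`.)
* `exists_epsilon_singular` — contrapositive, the form consumed by the counting argument of file
  3/3: with the same `ε₀`, if `u` is SINGULAR at the final-time point `x₀` (unbounded on every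
  `Q_ρ(0, x₀)`), then `ε₀³ r² < ∫_{−2r²}^{0} ∫_{B(x₀,r)} (|u|³ + |p|^{3/2})` for EVERY `r > 0`.

References: L. Caffarelli, R. Kohn, L. Nirenberg, Comm. Pure Appl. Math. 35 (1982), Prop. 1 /
Cor. 1; P. G. Lemarié-Rieusset, *The Navier–Stokes Problem in the 21st Century* (2016), Thm. 14.4.
-/

noncomputable section

-- the summit and its single sub-problem share the name (CONVENTIONS §1), as in every Theorems file
set_option linter.dupNamespace false

namespace Summit.NavierStokesRegularity.NavierStokesRegularity.Theorems.FiniteDissipationLiouville.Birth.Apex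

open MeasureTheory Set Filter Topology Metric Function TopologicalSpace
open Literature.Analysis Literature.Analysis.FluidPDE
open scoped ENNReal NNReal

/-- **One-scale ε-regularity at the final time for classical solutions on `(−∞, 0) × ℝ³`.**
There are absolute `ε₀, C₀ > 0` such that for every classical solution `(u, p)` of Navier–Stokes
(`ν = 1`, `f = 0`) on the time set `(−∞, 0)`, every `x₀` and every `r > 0`, the smallness
`∫_{−2r²}^{0} ∫_{B(x₀,r)} (|u|³ + |p|^{3/2}) ≤ ε₀³ r²` forces `|u(t, x)| ≤ C₀ ε₀ / r` for all
`t ∈ (−r²/4, 0)`, `x ∈ B(x₀, r/2)` (Lemarié-Rieusset 2016, Thm. 14.4, applied on the cylinders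
`Q_r(t/2, x₀)`, whose closures lie in the open slab). -/
theorem exists_epsilon_apex :
    ∃ ε₀ C₀ : ℝ, 0 < ε₀ ∧ 0 < C₀ ∧
      ∀ (u : ℝ → EuclideanSpace ℝ (Fin 3) → EuclideanSpace ℝ (Fin 3))
        (p : ℝ → EuclideanSpace ℝ (Fin 3) → ℝ), IsClassicalNSSolutionOn (Iio 0) 1 0 u p →
      ∀ (x₀ : EuclideanSpace ℝ (Fin 3)) (r : ℝ), 0 < r →
        ∫⁻ z in Ioo (-(2 * r ^ 2)) 0 ×ˢ ball x₀ r,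
            (‖u z.1 z.2‖ₑ ^ (3 : ℕ) + ‖p z.1 z.2‖ₑ ^ (3 / 2 : ℝ)) ≤ ENNReal.ofReal (ε₀ ^ 3 * r ^ 2) →
        ∀ t ∈ Ioo (-(r / 2) ^ 2) 0, ∀ x ∈ ball x₀ (r / 2), ‖u t x‖ ≤ C₀ * ε₀ / r := by
  obtain ⟨ε₀, C₀, hε₀, hC₀, H⟩ :=
    epsilonRegularity_of_isSuitableWeakSolutionOn lemarieRieusset_epsilon_regularity_holds one_pos
  refine ⟨ε₀, C₀, hε₀, hC₀, fun u p hsol x₀ r hr hsmall t ht x hx => ?_⟩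
  obtain ⟨hsws, -⟩ :=
    FrequencyRigidity.ScaledEnergySplit.stub_classicalSuitableSlab u p hsol
  have ht1 : -(r / 2) ^ 2 < t := ht.1
  have ht2 : t < 0 := ht.2
  have hr2 : (r / 2) ^ 2 = r ^ 2 / 4 := by ring
  rw [hr2] at ht1
  -- the cylinder `Q_r(t₀, x₀)` with top `t₀ = t/2 < 0`
  have ht₀ : t / 2 < 0 := by linarith
  have hbox : Icc (t / 2 - r ^ 2) (t / 2) ×ˢ closedBall x₀ r ⊆
      ((slab (EuclideanSpace ℝ (Fin 3)) (Iio 0) isOpen_Iio :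
        Opens (ℝ × EuclideanSpace ℝ (Fin 3))) : Set (ℝ × EuclideanSpace ℝ (Fin 3))) := by
    rw [coe_slab]
    exact prod_mono (fun s hs => lt_of_le_of_lt hs.2 ht₀) (subset_univ _)
  have hcyl : parabolicCylinder r ((t / 2, x₀) : ℝ × EuclideanSpace ℝ (Fin 3)) ⊆
      Ioo (-(2 * r ^ 2)) 0 ×ˢ ball x₀ r := by
    intro w hw
    rw [mem_parabolicCylinder] at hw
    obtain ⟨⟨h2, h3⟩, h4⟩ := hw
    refine ⟨⟨?_, h3.trans ht₀⟩, h4⟩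
    change t / 2 - r ^ 2 < w.1 at h2
    have hr0 : 0 ≤ r ^ 2 := sq_nonneg r
    linarith
  have hsmall' : ∫⁻ w in parabolicCylinder r ((t / 2, x₀) : ℝ × EuclideanSpace ℝ (Fin 3)),
      (‖u w.1 w.2‖ₑ ^ (3 : ℕ) + ‖p w.1 w.2‖ₑ ^ (3 / 2 : ℝ)) ≤ ENNReal.ofReal (ε₀ ^ 3 * r ^ 2) :=
    (lintegral_mono_set hcyl).trans hsmall
  have hae := H _ u p hsws (t / 2, x₀) r r hr le_rfl hbox hsmall'
  -- pointwise by continuity on the open slab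
  have hcont : ContinuousOn (uncurry u) (Iio 0 ×ˢ univ) := hsol.smooth_velocity.continuousOn
  have hV : parabolicCylinder (r / 2) ((t / 2, x₀) : ℝ × EuclideanSpace ℝ (Fin 3)) ⊆
      Iio 0 ×ˢ univ := by
    intro w hw
    rw [mem_parabolicCylinder] at hw
    exact ⟨hw.1.2.trans ht₀, mem_univ _⟩
  have hall := forall_norm_le_of_ae_restrict hcont (isOpen_parabolicCylinder _ _) hV hae
  have hmem : ((t, x) : ℝ × EuclideanSpace ℝ (Fin 3)) ∈
      parabolicCylinder (r / 2) ((t / 2, x₀) : ℝ × EuclideanSpace ℝ (Fin 3)) := by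
    rw [mem_parabolicCylinder]
    refine ⟨⟨?_, ?_⟩, hx⟩
    · change t / 2 - (r / 2) ^ 2 < t
      rw [hr2]
      linarith
    · change t < t / 2
      linarith
  have hfin : ‖u t x‖ ≤ C₀ * ε₀ / r := hall ((t, x) : ℝ × EuclideanSpace ℝ (Fin 3)) hmem
  exact hfin

/-- **ε-regularity at the final time, singular form.** With the absolute `ε₀ > 0` of
`exists_epsilon_apex`: if a classical solution `(u, p)` on `(−∞, 0) × ℝ³` is SINGULAR at the
final-time point `x₀` — unbounded on every backward cylinder `Q_ρ(0, x₀) = (−ρ², 0) × B(x₀, ρ)` —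
then `ε₀³ r² < ∫_{−2r²}^{0} ∫_{B(x₀,r)} (|u|³ + |p|^{3/2})` for every `r > 0`. -/
theorem exists_epsilon_singular :
    ∃ ε₀ : ℝ, 0 < ε₀ ∧
      ∀ (u : ℝ → EuclideanSpace ℝ (Fin 3) → EuclideanSpace ℝ (Fin 3))
        (p : ℝ → EuclideanSpace ℝ (Fin 3) → ℝ), IsClassicalNSSolutionOn (Iio 0) 1 0 u p →
      ∀ x₀ : EuclideanSpace ℝ (Fin 3),
        (∀ ρ > 0, ∀ M : ℝ, ∃ t ∈ Ioo (-(ρ ^ 2)) (0 : ℝ), ∃ x ∈ ball x₀ ρ, M < ‖u t x‖) →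
        ∀ r : ℝ, 0 < r →
          ENNReal.ofReal (ε₀ ^ 3 * r ^ 2) <
            ∫⁻ z in Ioo (-(2 * r ^ 2)) 0 ×ˢ ball x₀ r,
              (‖u z.1 z.2‖ₑ ^ (3 : ℕ) + ‖p z.1 z.2‖ₑ ^ (3 / 2 : ℝ)) := by
  obtain ⟨ε₀, C₀, hε₀, hC₀, H⟩ := exists_epsilon_apex
  refine ⟨ε₀, hε₀, fun u p hsol x₀ hsing r hr => ?_⟩
  refine lt_of_not_ge fun hsmall => ?_
  have hb := H u p hsol x₀ r hr hsmall
  obtain ⟨t, ht, x, hx, hM⟩ := hsing (r / 2) (by positivity) (C₀ * ε₀ / r)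
  have ht' : t ∈ Ioo (-(r / 2) ^ 2) 0 := by simpa using ht
  exact (not_lt.2 (hb t ht' x hx)) hM

end Summit.NavierStokesRegularity.NavierStokesRegularity.Theorems.FiniteDissipationLiouville.Birth.Apex

end
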